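import Mathlib
import Summits.Ventures.PercRepro2.Defs
import Summits.Ventures.PercRepro2.Graph
import Summits.Ventures.PercRepro2.Explore

/-!
# The exploration from `a₁` halted when `a₃` joins, as a stopping rule that DECIDES `{a₃ ∈ C₁}`
(blind cell PercRepro2, p1 g13; ASSIGNMENTS v12.50 (4) «the `IsCylinderPartition` instance for the
a₁-rooted «stop when a₃ joins» records»; typer-1 `Explore.lean`: «the BFS-from-`a₁`-until-`a₃`
exploration is ONE stopping rule (its construction is a separate file)»)

The exploration keeps a state `(reached, explored)` — the reached vertices in arrival order and the
explored edges. A **selector** (`Selector`) picks, from the state alone, an unexplored edge touching a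
reached vertex (or `none` when there is none): the fixed-edge-order selector `fixedOrder`, the BFS
selector `bfs` (first reached vertex with an unexplored incident edge, in arrival order) and the DFS
selector `dfs` (last such vertex) are instances. One step (`haltStep`): if `a₃` is reached, halt;
otherwise explore the picked edge — if open, append its endpoints. After `|E|` steps (`haltFinal`) the
exploration is halted (`halted_final`: every step that is not halted explores a new edge). The
record `haltRecord ω` = (explored edges open in `ω`, explored edges closed in `ω`) is a
`StoppingRule` (**`haltRule`**): it reads only the explored edges (`haltRun_eq_of_agree`). That it
DECIDES `{a₃ ∈ C₁}` is `ExploreHaltDecides.lean` (`haltRule_decides`). Nothing about `PM ≥ 0` is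
claimed. -/

namespace Summit.Ventures.PercRepro2

namespace Explore

section Halt
variable {V : Type*} {E : Type*}

/-- The state of an exploration: the reached vertices (arrival order) and the explored edges. -/
structure HaltState (V E : Type*) where
  /-- reached vertices, in arrival order -/
  reached : List V
  /-- explored edges -/
  explored : Finset E

/-- A selector: from the reached list and the explored set it picks an unexplored edge touching a
reached vertex, and returns `none` only when there is no such edge. -/
structure Selector (ends : E → Sym2 V) where
  /-- the picked edge -/
  pick : List V → Finset E → Option E
  /-- a picked edge is unexplored and touches a reached vertex -/
  pick_some : ∀ R X e, pick R X = some e → e ∉ X ∧ ∃ v ∈ R, v ∈ ends e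
  /-- `none` only when no unexplored edge touches a reached vertex -/
  pick_none : ∀ R X, pick R X = none → ∀ e, e ∉ X → ∀ v ∈ R, v ∉ ends e

variable [DecidableEq V] [Fintype V] (ends : E → Sym2 V)

/-- The endpoints of `e` not yet reached, as a list. -/
noncomputable def newEnds (R : List V) (e : E) : List V :=
  (Finset.univ.filter (fun v => v ∈ ends e ∧ v ∉ R)).toList

/-- Every endpoint of `e` is reached after appending `newEnds`. -/
lemma mem_append_newEnds {R : List V} {e : E} {v : V} (hv : v ∈ ends e) :
    v ∈ R ++ newEnds ends R e := by
  rw [List.mem_append]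
  by_cases hR : v ∈ R
  · exact Or.inl hR
  · right
    unfold newEnds
    rw [Finset.mem_toList, Finset.mem_filter]
    exact ⟨Finset.mem_univ v, hv, hR⟩

variable {ends} [DecidableEq E]

/-- One step of the exploration halted at `a₃`: halt if `a₃` is reached; otherwise explore the picked
edge, appending its endpoints when it is open. -/
noncomputable def haltStep (sel : Selector ends) (a₃ : V) (ω : Config E) (s : HaltState V E) :
    HaltState V E :=
  if a₃ ∈ s.reached then s
  else
    match sel.pick s.reached s.explored with
    | none => s
    | some e =>
      if ω e = true then ⟨s.reached ++ newEnds ends s.reached e, insert e s.explored⟩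
      else ⟨s.reached, insert e s.explored⟩

/-- The state after `n` steps from `a₁`. -/
noncomputable def haltRun (sel : Selector ends) (a₁ a₃ : V) (ω : Config E) (n : ℕ) :
    HaltState V E :=
  (haltStep sel a₃ ω)^[n] ⟨[a₁], ∅⟩

/-- `haltRun (n + 1) = haltStep (haltRun n)`. -/
lemma haltRun_succ (sel : Selector ends) (a₁ a₃ : V) (ω : Config E) (n : ℕ) :
    haltRun sel a₁ a₃ ω (n + 1) = haltStep sel a₃ ω (haltRun sel a₁ a₃ ω n) := by
  unfold haltRun
  exact Function.iterate_succ_apply' _ _ _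

/-- A halted state: `a₃` reached, or nothing left to explore. -/
def Halted (sel : Selector ends) (a₃ : V) (s : HaltState V E) : Prop :=
  a₃ ∈ s.reached ∨ sel.pick s.reached s.explored = none

/-- A halted state is fixed by the step. -/
lemma haltStep_of_halted {sel : Selector ends} {a₃ : V} (ω : Config E) {s : HaltState V E}
    (h : Halted sel a₃ s) : haltStep sel a₃ ω s = s := by
  unfold haltStep
  rcases h with h | h
  · simp [h]
  · by_cases h3 : a₃ ∈ s.reached
    · simp [h3]
    · simp [h3, h]

/-- The four shapes of a step. -/
lemma haltStep_cases (sel : Selector ends) (a₃ : V) (ω : Config E) (s : HaltState V E) :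
    haltStep sel a₃ ω s = s ∨
      ∃ e, sel.pick s.reached s.explored = some e ∧ a₃ ∉ s.reached ∧
        ((ω e = true ∧ haltStep sel a₃ ω s = ⟨s.reached ++ newEnds ends s.reached e, insert e s.explored⟩) ∨
          (ω e = false ∧ haltStep sel a₃ ω s = ⟨s.reached, insert e s.explored⟩)) := by
  by_cases h3 : a₃ ∈ s.reached
  · left; simp [haltStep, h3]
  · cases hp : sel.pick s.reached s.explored with
    | none => left; simp [haltStep, h3, hp]
    | some e =>
      right
      refine ⟨e, rfl, h3, ?_⟩
      cases hω : ω e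
      · right; exact ⟨rfl, by simp [haltStep, h3, hp, hω]⟩
      · left; exact ⟨rfl, by simp [haltStep, h3, hp, hω]⟩

/-- Reached vertices stay reached. -/
lemma mem_reached_haltStep (sel : Selector ends) (a₃ : V) (ω : Config E) (s : HaltState V E)
    {v : V} (hv : v ∈ s.reached) : v ∈ (haltStep sel a₃ ω s).reached := by
  rcases haltStep_cases sel a₃ ω s with h | ⟨e, _, _, ⟨_, h⟩ | ⟨_, h⟩⟩
  · rw [h]; exact hv
  · rw [h]; exact List.mem_append_left _ hv
  · rw [h]; exact hv

/-- Explored edges stay explored. -/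
lemma explored_subset_haltStep (sel : Selector ends) (a₃ : V) (ω : Config E) (s : HaltState V E) :
    s.explored ⊆ (haltStep sel a₃ ω s).explored := by
  rcases haltStep_cases sel a₃ ω s with h | ⟨e, _, _, ⟨_, h⟩ | ⟨_, h⟩⟩
  · rw [h]
  · rw [h]; exact Finset.subset_insert _ _
  · rw [h]; exact Finset.subset_insert _ _

/-- Explored edges are monotone along the run. -/
lemma explored_mono (sel : Selector ends) (a₁ a₃ : V) (ω : Config E) {m n : ℕ} (h : m ≤ n) :
    (haltRun sel a₁ a₃ ω m).explored ⊆ (haltRun sel a₁ a₃ ω n).explored := by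
  induction n with
  | zero =>
    have : m = 0 := Nat.le_zero.1 h
    subst this; exact le_rfl
  | succ n ih =>
    rcases Nat.le_succ_iff.1 h with h | h
    · exact (ih h).trans (by rw [haltRun_succ]; exact explored_subset_haltStep _ _ _ _)
    · subst h; exact le_rfl

/-- Reached vertices are monotone along the run. -/
lemma mem_reached_mono (sel : Selector ends) (a₁ a₃ : V) (ω : Config E) {m n : ℕ} (h : m ≤ n)
    {v : V} (hv : v ∈ (haltRun sel a₁ a₃ ω m).reached) : v ∈ (haltRun sel a₁ a₃ ω n).reached := by
  induction n with
  | zero =>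
    have : m = 0 := Nat.le_zero.1 h
    subst this; exact hv
  | succ n ih =>
    rcases Nat.le_succ_iff.1 h with h | h
    · rw [haltRun_succ]; exact mem_reached_haltStep _ _ _ _ (ih h)
    · subst h; exact hv

/-- **The step reads only the edge it explores**: two configurations agreeing on the explored edges of
the new state take the same step. -/
lemma haltStep_eq_of_agree (sel : Selector ends) (a₃ : V) (ω ω' : Config E) (s : HaltState V E)
    (h : ∀ e ∈ (haltStep sel a₃ ω s).explored, ω' e = ω e) :
    haltStep sel a₃ ω' s = haltStep sel a₃ ω s := by
  by_cases h3 : a₃ ∈ s.reached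
  · simp [haltStep, h3]
  · cases hp : sel.pick s.reached s.explored with
    | none => simp [haltStep, h3, hp]
    | some e =>
      have he : e ∈ (haltStep sel a₃ ω s).explored := by
        cases hω : ω e <;> simp [haltStep, h3, hp, hω]
      have hωe : ω' e = ω e := h e he
      cases hω : ω e
      · rw [hω] at hωe; simp [haltStep, h3, hp, hω, hωe]
      · rw [hω] at hωe; simp [haltStep, h3, hp, hω, hωe]

/-- **The run reads only the explored edges**: agreement on the edges explored by step `N` gives the
same states up to step `N`. -/
lemma haltRun_eq_of_agree (sel : Selector ends) (a₁ a₃ : V) (ω ω' : Config E) (N : ℕ)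
    (h : ∀ e ∈ (haltRun sel a₁ a₃ ω N).explored, ω' e = ω e) :
    ∀ n ≤ N, haltRun sel a₁ a₃ ω' n = haltRun sel a₁ a₃ ω n := by
  intro n hn
  induction n with
  | zero => rfl
  | succ n ih =>
    rw [haltRun_succ, haltRun_succ, ih (Nat.le_of_succ_le hn)]
    apply haltStep_eq_of_agree
    intro e he
    apply h
    rw [← haltRun_succ] at he
    exact explored_mono sel a₁ a₃ ω hn he

end Halt

section Rule
variable {V : Type*} {E : Type*} [DecidableEq V] [DecidableEq E] [Fintype V] [Fintype E]
  {ends : E → Sym2 V}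

/-- The final state: `|E|` steps from `a₁`. -/
noncomputable def haltFinal (sel : Selector ends) (a₁ a₃ : V) (ω : Config E) : HaltState V E :=
  haltRun sel a₁ a₃ ω (Fintype.card E)

/-- The record of the halted exploration: explored edges open in `ω` / closed in `ω`. -/
noncomputable def haltRecord (sel : Selector ends) (a₁ a₃ : V) (ω : Config E) : Record E :=
  ⟨(haltFinal sel a₁ a₃ ω).explored.filter (fun e => ω e = true),
    (haltFinal sel a₁ a₃ ω).explored.filter (fun e => ω e = false),
    Finset.disjoint_filter.2 fun e _ h1 h2 => by rw [h1] at h2; exact Bool.noConfusion h2⟩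

/-- The explored edges of the record are the explored edges of the final state. -/
lemma haltRecord_explored (sel : Selector ends) (a₁ a₃ : V) (ω : Config E) :
    (haltRecord sel a₁ a₃ ω).explored = (haltFinal sel a₁ a₃ ω).explored := by
  ext e
  simp only [haltRecord, Record.explored, Finset.mem_union, Finset.mem_filter]
  constructor
  · rintro (⟨h, _⟩ | ⟨h, _⟩) <;> exact h
  · intro h
    cases hω : ω e
    · exact Or.inr ⟨h, rfl⟩
    · exact Or.inl ⟨h, rfl⟩

/-- **The halted exploration is a stopping rule.** -/
noncomputable def haltRule (sel : Selector ends) (a₁ a₃ : V) : StoppingRule E where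
  record := haltRecord sel a₁ a₃
  consistent := fun ω => by
    refine ⟨fun e he => ?_, fun e he => ?_⟩
    · exact (Finset.mem_filter.1 he).2
    · exact (Finset.mem_filter.1 he).2
  stopping := fun ω ω' h => by
    rw [haltRecord_explored] at h
    have hfin : haltFinal sel a₁ a₃ ω' = haltFinal sel a₁ a₃ ω :=
      haltRun_eq_of_agree sel a₁ a₃ ω ω' (Fintype.card E) h _ le_rfl
    apply Record.ext
    · show (haltFinal sel a₁ a₃ ω').explored.filter (fun e => ω' e = true) =
        (haltFinal sel a₁ a₃ ω).explored.filter (fun e => ω e = true)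
      rw [hfin]
      exact Finset.filter_congr fun e he => by rw [h e he]
    · show (haltFinal sel a₁ a₃ ω').explored.filter (fun e => ω' e = false) =
        (haltFinal sel a₁ a₃ ω).explored.filter (fun e => ω e = false)
      rw [hfin]
      exact Finset.filter_congr fun e he => by rw [h e he]

/-- `(haltRule sel a₁ a₃).record ω = haltRecord sel a₁ a₃ ω`. -/
lemma haltRule_record (sel : Selector ends) (a₁ a₃ : V) (ω : Config E) :
    (haltRule sel a₁ a₃).record ω = haltRecord sel a₁ a₃ ω := rfl

end Rule

/-! ## Selectors: fixed edge order, BFS, DFS -/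

section Selectors
variable {V : Type*} {E : Type*} [DecidableEq V] [DecidableEq E] (ends : E → Sym2 V)

/-- The fixed-edge-order selector: the first edge of `order` that is unexplored and touches a reached
vertex. -/
def fixedOrder (order : List E) (horder : ∀ e, e ∈ order) : Selector ends where
  pick R X := order.find? (fun e => e ∉ X ∧ ∃ v ∈ R, v ∈ ends e)
  pick_some R X e h := by
    have := List.find?_some h
    simpa using this
  pick_none R X h e he v hv hvE := by
    have := List.find?_eq_none.1 h e (horder e)
    simp only [decide_eq_true_eq, not_and, not_exists] at this
    exact this he v hv hvE

/-- The BFS selector: the first reached vertex (arrival order) with an unexplored incident edge, and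
its first such edge in `order`. -/
def bfs (order : List E) (horder : ∀ e, e ∈ order) : Selector ends where
  pick R X := R.findSome? (fun v => order.find? (fun e => e ∉ X ∧ v ∈ ends e))
  pick_some R X e h := by
    obtain ⟨v, hv, hfind⟩ := List.exists_of_findSome?_eq_some h
    have := List.find?_some hfind
    simp only [decide_eq_true_eq] at this
    exact ⟨this.1, v, hv, this.2⟩
  pick_none R X h e he v hv hvE := by
    have hnone := List.findSome?_eq_none_iff.1 h v hv
    have := List.find?_eq_none.1 hnone e (horder e)
    simp only [decide_eq_true_eq, not_and] at this
    exact this he hvE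

/-- The DFS selector: the last reached vertex (arrival order) with an unexplored incident edge. -/
def dfs (order : List E) (horder : ∀ e, e ∈ order) : Selector ends where
  pick R X := R.reverse.findSome? (fun v => order.find? (fun e => e ∉ X ∧ v ∈ ends e))
  pick_some R X e h := by
    obtain ⟨v, hv, hfind⟩ := List.exists_of_findSome?_eq_some h
    have := List.find?_some hfind
    simp only [decide_eq_true_eq] at this
    exact ⟨this.1, v, List.mem_reverse.1 hv, this.2⟩
  pick_none R X h e he v hv hvE := by
    have hnone := List.findSome?_eq_none_iff.1 h v (List.mem_reverse.2 hv)
    have := List.find?_eq_none.1 hnone e (horder e)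
    simp only [decide_eq_true_eq, not_and] at this
    exact this he hvE

end Selectors

end Explore

end Summit.Ventures.PercRepro2
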